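import Literature.IUT.LogThetaLattice.MultiradialityRemarksRmk212Proofs
import Literature.IUT.HodgeTheaters.ProfiniteCompletionZHatCharacters
import Literature.AnabelianGeometry.AbsoluteAnabelian.MonoidKummerModel
import HarnessLib

/-!
# [IUTchIII] Rmk 2.1.2 (ii) — `N_{Π̂}(Π†)/Π† ≅ Ẑ/ℤ` at the tree's `Ẑ := profiniteCompletion ℤ`: hypothesis-free instance
# forms of F-1785 `MultiradialityRemarks.Rmk212ii_normalizerQuotient` in print's own shape `Π̂ ↠ Ẑ ⊇ ℤ`, `Π† := Π̂ ×_Ẑ ℤ`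

S. Mochizuki, *Inter-universal Teichmüller theory III*, kurims manuscript, §2, Remark 2.1.2 (ii), p. 64 l. 22 – p. 65 l. 5
[cite: Mochizuki2012, IUTchIII Rmk 2.1.2 (ii) pp.64–65] (D-0012 claim key, status disputed; elementary profinite group
theory only — nothing of the series is asserted).  abc-iut cell, seat abc-iut-f-120 (staged gen 7, filed gen 9); BY-NAME SUPPLY
for L6 ROWS #5 row R5-6 «LF6-52» (holder of record abc-iut-L6-t4, «TAKE» 2026-08-27T04:36Z; frozen FACT-LIST row **F-1785**;
the GENERIC profinite-completion form, register column (d)).  PROOF-ONLY companion of abc-iut-L6-t4's `MultiradialityRemarks.lean`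
(the decl, p404906) and abc-iut-L6-t19's `MultiradialityRemarksRmk212Proofs.lean` (p418103; the producer
`rmk212ii_normalizerQuotient_of_surjective`, 1 Prop hypothesis `hf : Surjective f` over a FREE target `A`): no `def`, no
`structure`, no `instance`, nothing re-typed.

RELATION TO THE MODEL INSTANCES OF RECORD (abc-iut-L6-t4, `MultiradialityRemarksRmk212iiAtTemperedModels.lean`, p496437): that
file proves the row AT THE CELL'S GENUINE MODELS with target literally `Ẑ/ℤ` — `rmk212ii_normalizerQuotient_gfpFst` (geometric
[EtTh] §1 model, `Π† = pr₁(Γ) = ê⁻¹(ι ℤ) ⊆ F̂₂` via the character `ê : F̂₂ ↠ Ẑ`) and `rmk212ii_normalizerQuotient_curveχ` (stage-1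
χ-twisted arithmetic model).  The present file is the GENERIC form over ANY discrete group `K` with a surjective character
`f : K ↠ ℤ` and ANY continuous `φ : K̂ → Ẑ` extending it; its closed instance `rmk212ii_normalizerQuotient_zHat_freeGroup`
(`K := FreeGroup (Fin 2)`, `f :=` exponent sum of the first generator, `φ` from `ProfiniteCompletion.exists_zHat_extension`)
COINCIDES IN CONTENT with p496437's `rmk212ii_normalizerQuotient_gfpFst` (there `Π̂ = F̂₂ = F₂hatT` and `φ = ê` extends the same
exponent-sum character `expA`); it is kept here only as the 0-hypothesis specialisation of the generic theorem and restates
nothing of p496437.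

PRINT (p. 64): "the surjections `Π ↠ l·ℤ`, `Π̂ ↠ l·Ẑ`", "`Π† := Π̂ ×_{Ẑ} ℤ ⊆ Π̂`", "the [easily verified] natural isomorphism
`N_{Π̂}(Π†)/Π† ⥲ Ẑ/ℤ`".  THE INSTANCE FORMS HERE put the producer AT THE TREE'S OWN `Ẑ` (`Literature.IUT.HodgeTheaters.ZHat :=
profiniteCompletion (Multiplicative ℤ)`, universe 0 — so the groups `K` below live in `Type`, as the decl takes `Π̂` and the target in ONE universe; with `η_ℤ : ℤ → Ẑ` = `toCompletion`) and AT A PROFINITE COMPLETION `Π̂ := K̂` carrying a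
continuous `φ : K̂ → Ẑ` that EXTENDS a surjective integral character `f : K ↠ ℤ` of the discrete group `K` (print's `Π ↠ l·ℤ`;
the extension exists by abc-iut's `ProfiniteCompletion.exists_zHat_extension`, [IUTchI] Lem 2.7 lineage):

* `surjective_of_extends_surjective` — such a `φ` is SURJECTIVE (`φ(K̂)` is compact hence closed and contains the dense `η_ℤ(ℤ)`);
* **`rmk212ii_normalizerQuotient_zHat_of_extends`** — for `Π† := φ⁻¹(η_ℤ(ℤ))` («`Π̂ ×_Ẑ ℤ`»):
  `Rmk212ii_normalizerQuotient Π† (Ẑ ⧸ η_ℤ(ℤ))`, hypotheses = print's data only (`f` surjective, `φ` continuous extending `f`);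
* **`exists_rmk212ii_normalizerQuotient_zHat`** — for EVERY discrete group `K` with a surjective character `f : K ↠ ℤ` there IS such
  a `φ`, and the row holds for its `Π†` — 0 Prop hypotheses beyond `Surjective f`;
* **`rmk212ii_normalizerQuotient_zHat_freeGroup`** — CLOSED instance, 0 hypotheses: `K := FreeGroup (Fin 2)` (the topological
  fundamental group of a once-punctured elliptic curve is free of rank 2; `Π̂ := ` its profinite completion), `f :=` the exponent
  sum of the first generator.

HONEST LABEL: instance forms at OUR `Ẑ` and OUR profinite completions; the identification of `K̂` with the geometric fundamental
group `Π̂` of print and of `f` with the theta-quotient `Π ↠ l·ℤ` is NOT made here (no tree object carries it); an instance-form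
theorem at our model is not the print universal closure (REFUTED: `not_forall_Rmk212ii_normalizerQuotient`, p417614); nothing of
the series is asserted; no side taken on [IUTchIII] Cor 3.12; typed ≠ proved; nothing here asserts abc proved or refuted.
-/

noncomputable section

namespace Literature.IUT.LogThetaLattice.MultiradialityRemarks

open Literature.IUT.HodgeTheaters

/-- A continuous homomorphism `φ : K̂ → Ẑ` from a profinite completion that EXTENDS a surjective integral character `f : K ↠ ℤ`
(`φ ∘ η_K = η_ℤ ∘ f`) is surjective: its image is compact, hence closed, and contains the dense subgroup `η_ℤ(ℤ) ⊆ Ẑ`.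
[folklore] ([IUTchIII] Rmk 2.1.2 (ii) p.64 "the surjection `Π̂ ↠ l·Ẑ`") [claim: Mochizuki2012, status: disputed] -/
theorem surjective_of_extends_surjective {K : Type} [Group K] (f : K →* Multiplicative ℤ)
    (hf : Function.Surjective f) (φ : profiniteCompletion K →* ZHat) (hφc : Continuous φ)
    (hφ : ∀ k : K, φ (toCompletion K k) = toCompletion (Multiplicative ℤ) (f k)) :
    Function.Surjective φ := by
  have hdense : DenseRange (toCompletion (Multiplicative ℤ)) :=
    ProfiniteGrp.ProfiniteCompletion.denseRange (GrpCat.of (Multiplicative ℤ))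
  have hsub : Set.range (toCompletion (Multiplicative ℤ)) ⊆ Set.range φ := by
    rintro _ ⟨n, rfl⟩
    obtain ⟨k, rfl⟩ := hf n
    exact ⟨toCompletion K k, hφ k⟩
  have hclosed : IsClosed (Set.range φ) := (isCompact_range hφc).isClosed
  rw [← Set.range_eq_univ, ← hclosed.closure_eq]
  exact (hdense.mono hsub).closure_eq

/-- **IUTchIII:Rmk2.1.2(ii) at the tree's `Ẑ`** (kurims p. 64 "`Π† := Π̂ ×_{Ẑ} ℤ ⊆ Π̂` … the natural isomorphism
`N_{Π̂}(Π†)/Π† ⥲ Ẑ/ℤ`"): for a discrete group `K` with a SURJECTIVE character `f : K ↠ ℤ` (print: `Π ↠ l·ℤ ≅ ℤ`) and a continuous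
`φ : K̂ → Ẑ` extending it (print: `Π̂ ↠ l·Ẑ`), the partially tempered subgroup `Π† := φ⁻¹(η_ℤ(ℤ))` of `Π̂ := K̂` satisfies
abc-iut-L6-t4's decl `Rmk212ii_normalizerQuotient Π† (Ẑ ⧸ η_ℤ(ℤ))` — by abc-iut-L6-t19's `rmk212ii_normalizerQuotient_of_surjective`
(`Ẑ` is commutative: the tree's `SemiGraphs.ZHat.instCommGroup`) and `surjective_of_extends_surjective`.  PROVED; hypotheses =
print's data only. ([IUTchIII] Rmk 2.1.2 (ii) p.64) [claim: Mochizuki2012, status: disputed] -/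
theorem rmk212ii_normalizerQuotient_zHat_of_extends {K : Type} [Group K] (f : K →* Multiplicative ℤ)
    (hf : Function.Surjective f) (φ : profiniteCompletion K →* ZHat) (hφc : Continuous φ)
    (hφ : ∀ k : K, φ (toCompletion K k) = toCompletion (Multiplicative ℤ) (f k)) :
    Rmk212ii_normalizerQuotient ((toCompletion (Multiplicative ℤ)).range.comap φ)
      (ZHat ⧸ (toCompletion (Multiplicative ℤ)).range) :=
  rmk212ii_normalizerQuotient_of_surjective φ (surjective_of_extends_surjective f hf φ hφc hφ) _

/-- **IUTchIII:Rmk2.1.2(ii) — existence form, 0 Prop hypotheses beyond print's `Π ↠ ℤ`**: for EVERY discrete group `K` with a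
surjective character `f : K ↠ ℤ` there is a continuous SURJECTION `φ : K̂ ↠ Ẑ` extending `f` (abc-iut's
`ProfiniteCompletion.exists_zHat_extension`), and for its `Π† := φ⁻¹(η_ℤ(ℤ))` the row F-1785 holds with target `Ẑ ⧸ η_ℤ(ℤ)`.
PROVED. ([IUTchIII] Rmk 2.1.2 (ii) p.64) [claim: Mochizuki2012, status: disputed] -/
theorem exists_rmk212ii_normalizerQuotient_zHat {K : Type} [Group K] (f : K →* Multiplicative ℤ)
    (hf : Function.Surjective f) :
    ∃ φ : profiniteCompletion K →* ZHat, Continuous φ ∧ Function.Surjective φ ∧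
      (∀ k : K, φ (toCompletion K k) = toCompletion (Multiplicative ℤ) (f k)) ∧
      Rmk212ii_normalizerQuotient ((toCompletion (Multiplicative ℤ)).range.comap φ)
        (ZHat ⧸ (toCompletion (Multiplicative ℤ)).range) := by
  obtain ⟨φ, hφc, hφ⟩ := ProfiniteCompletion.exists_zHat_extension f
  exact ⟨φ, hφc, surjective_of_extends_surjective f hf φ hφc hφ, hφ,
    rmk212ii_normalizerQuotient_zHat_of_extends f hf φ hφc hφ⟩

/-- The exponent-sum-of-the-first-generator character `F₂ ↠ ℤ` of the free group on two generators is surjective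
(private helper for the closed instance below). [folklore] -/
private theorem freeGroup_fst_character_surjective :
    Function.Surjective (FreeGroup.lift (fun i : Fin 2 => if i = 0 then Multiplicative.ofAdd (1 : ℤ) else 1)) := by
  intro n
  refine ⟨FreeGroup.of 0 ^ (Multiplicative.toAdd n), ?_⟩
  rw [map_zpow, FreeGroup.lift_apply_of, if_pos rfl, ← ofAdd_zsmul, smul_eq_mul, mul_one, ofAdd_toAdd]

/-- **IUTchIII:Rmk2.1.2(ii) — CLOSED instance of F-1785, 0 hypotheses**: `K := FreeGroup (Fin 2)` (the topological fundamental
group of a once-punctured elliptic curve; `Π̂ := K̂` its profinite completion, a free profinite group of rank 2), `f :=` the exponent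
sum of the first generator (`Π ↠ ℤ`): there is a continuous surjection `φ : K̂ ↠ Ẑ` extending `f`, and
`Rmk212ii_normalizerQuotient (φ⁻¹(η_ℤ(ℤ))) (Ẑ ⧸ η_ℤ(ℤ))` — `N_{Π̂}(Π†)/Π† ≅ Ẑ/ℤ`.  PROVED. ([IUTchIII] Rmk 2.1.2 (ii) p.64)
[claim: Mochizuki2012, status: disputed] -/
theorem rmk212ii_normalizerQuotient_zHat_freeGroup :
    ∃ φ : profiniteCompletion (FreeGroup (Fin 2)) →* ZHat, Continuous φ ∧ Function.Surjective φ ∧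
      (∀ k : FreeGroup (Fin 2), φ (toCompletion (FreeGroup (Fin 2)) k) =
        toCompletion (Multiplicative ℤ)
          (FreeGroup.lift (fun i : Fin 2 => if i = 0 then Multiplicative.ofAdd (1 : ℤ) else 1) k)) ∧
      Rmk212ii_normalizerQuotient ((toCompletion (Multiplicative ℤ)).range.comap φ)
        (ZHat ⧸ (toCompletion (Multiplicative ℤ)).range) :=
  exists_rmk212ii_normalizerQuotient_zHat _ freeGroup_fst_character_surjective

end Literature.IUT.LogThetaLattice.MultiradialityRemarks

end
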